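import Summits.QuantumFields.YangMills.Theorems.FluctuationComparisonRegPrIntLS2BetaRelativeStokes
import Literature.MathematicalPhysics.QuantumFieldTheory.Balaban1983to89.T3PrintedRegularOrbits
import Literature.MathematicalPhysics.QuantumFieldTheory.Balaban1983to89.T4PairDerivBridge
import HarnessLib

/-!
# S2β · GAP♯∘ — (RES-u.4) «THE COMMUTATOR LETTER»: the bond sizes of the relative field after the block-constant half `ǔ` of the
# Thm-2 representative's gauge is moved onto the background — `dist1 (X b·((c•U₀) b)⁻¹) ≤ a + 2·σ·τ + τ′`, NO stabiliser, NO inverse orbit bound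

Cell `ym3-torus` (rung R3 = continuum `SU(2)` YM₃ on T³ at fixed lattice data — NOT d = 4, NOT infinite volume, NOT a mass gap, NOT Clay).
Width seat `ym-ust-20520-w5` (gen 28), explicit-unit helper on crux `stmt-QuantumFields-20520` `FluctuationComparisonRegPrIntL`, LINE g18-1 S2β
(registry `Lines/semiclassical_s2beta.lean` untouched), organ GAP♯∘, node (RES-u) «from Thm 2's `u` to a residual re-gauging».
ARCHITECT px17 g23 (2026-09-01T01:09:08Z) RULING + SPEC «TRIPLE MOVE + COMMUTATOR LETTER — NO INVERSE ORBIT BOUND», desk ★★OWNER g50 WORD №704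
(the (RES-u) of record; inputs `(a, σ̄, τ ≤ O(1), τ′)`), holders: (RES-u.0)–(RES-u.3) px16 g24 (doors ✓-pending `…S2BetaBodyRebaseResidual`),
**(RES-u.4) = THIS FILE**, (RES-u.5) px13 g29 (oscillation ∕ read-cell packaging).

THE MATHEMATICS (group algebra over the `dist1` axioms of `GaugeGroup`, one displayed commutator estimate `hcomm`, discharged on `SU(n)` by
✓`dist1_comm_le_SU`).  Write `u = ǔ·r` with `ǔ` BLOCK-CONSTANT (a lift `liftTransfTo t` of a coarse transformation `t`) and `r` residual; the triple
move puts the new pair `(X, c•U₀)` (`X := u•U`, `c := ǔ`) in one fibre, and the new relative field splits as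
`X b·((c•U₀) b)⁻¹ = (X b·(U₀ b)⁻¹)·(U₀ b·((c•U₀) b)⁻¹)` (§1 `rel_split_eq`).  The first factor is Thm 2's `e^{ηA(b)}` (size `a`, a LETTER here);
the second is PURE ALGEBRA (§1 ★`rel_gaugeAct_eq_comm_mul`):
`U₀ b·((c•U₀) b)⁻¹ = [U₀ b, c b₊]·(c b₊·(c b₋)⁻¹)`, a COMMUTATOR with the block constant times the GRADIENT of `c` across the bond — so
(§1 ★`dist1_rel_gaugeAct_le`) `dist1 ≤ 2·dist1(U₀ b)·dist1(c b₊) + dist1(c b₊·(c b₋)⁻¹)`, and on a bond INTERIOR to a block (`c b₋ = c b₊`) the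
gradient term vanishes.  §2 ★★★`dist1_rel_blockRegauged_le`: with `hA` (closeness `a`), `hσ` (background bond class `σ`), `hτ` (size of `c`, only
through a free real `τ` — desk №704: `τ` is NOT small, `t` being only an `α₁`-approximate stabiliser of `V`; the `SU(n)` edition sets `τ := 2` by
✓`dist1_le_two_specialUnitaryGroup`) and `hτ′` (coarse gradient `τ′`): `dist1 (X b·((c•U₀) b)⁻¹) ≤ a + 2·σ·τ + τ′` (`SU(n)`: `≤ a + 4·σ + τ′`).
§3 THE SEAM INPUT `τ′` FROM THE DEFECT IDENTITY, POINTWISE (desk №704 (ii); the identity `t⁻¹•V = e^{iB}·V` itself is (RES-u.0), px16's — here a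
HYPOTHESIS `h`): from `(t y)⁻¹·V(b)·t y′ = E(b)·V(b)` on a coarse bond `b : y → y′`,
`t y′·(t y)⁻¹`'s size obeys ★`dist1_coarseGrad_le_of_defect`: `dist1 (t b₊·(t b₋)⁻¹) ≤ 2·dist1(t b₋)·dist1(V b) + dist1(E b)` (`SU(n)`: `≤ 4·σ_V + e`),
both frame conventions (`E·V` and `V·E`), and §3′ the FRAMED edition `t⁻¹•V = w•(E·V)` (px16 g24's B7 (82)∕(85)∕(89) reading: the axial frame
gauge `w` costs its own gradient `ω′`, additively: `≤ 2·τ·σV + e + ω′`, `SU(n)`: `≤ 4·σV + e + ω′`); the orientation bridge `dist1 (g·h⁻¹) = dist1 (h⁻¹·g)` is the landed ✓`dist1_mul_inv_eq_rel`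
(`…S2BetaRelativeStokes`, imported).  §4 THE BLOCK-CONSTANT INSTANCE `c := liftTransfTo F n K h t`: `c z = t (π z)` (`rfl`, `π = siteShift⁻¹ ∘ blockUp (K−n)`),
so `c`'s gradient across a fine bond IS `t`'s gradient across the image pair, and VANISHES when both ends lie in one block.
`--kind proof --supports stmt-QuantumFields-20520 --as helper`, DEFINITION-FREE (0 `def`, 0 `instance`, 0 `sorry`; default heartbeats).

HONEST.  Pointwise group algebra; `hA` ∕ `hσ` ∕ `hτ` ∕ `hτ′` ∕ the defect identity `h` are HYPOTHESES (their sources — [Balaban1985RegularSpaces] Thm 2 p.83 (1.29)∕(1.37) = `C137T` on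
`B := logCovIter(U₀, iηA, k)`, the tower law, a small-bond presentation of `V` — are the lineage's (RES-u.0)∕(RES-u.5), NOT here); nothing of Bałaban's
analysis is asserted ([Balaban1985Averaging] (8) p.18, (11)–(13) p.19 for the gauge action and block-constant lifts; [Balaban1985RegularSpaces]
Thm 2 p.83, (1.29), (1.36)–(1.38) p.82 for the representative `u`); (RES-u), (REG), (REG-UP), `hBG`, GAP♯∘ (`stub_uniformFibreGapOrbit`, 0∕5), the five REGISTERED stubs, S2β, crux 20520, 19936, 19200,
`YM3TorusSU2` NOT proved; no summit statement is proved by a helper; rung R3 = SU(2) YM₃ on T³ — NOT d = 4, NOT infinite volume, NOT a mass gap, NOT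
Clay; the Yang–Mills mass gap is NOT proved.
-/

set_option autoImplicit false

noncomputable section

namespace Summit.QuantumFields.YangMills.Theorems.FluctuationComparisonRegPrIntLS2BetaResidualCommutatorLetter

open Literature.MathematicalPhysics.QuantumFieldTheory.Balaban1983to89
open T3ContinuumYM3Torus T3LevelShift T4Continuum
open T3UnitLawGaugeInvariance (blockUp)
open T3PrintedRegularOrbits (liftTransfTo sites_eq)
open T4PairDerivBridge (dist1_le_two_specialUnitaryGroup)
open Summit.QuantumFields.YangMills.Theorems.FluctuationComparisonRegPrIntLS2BetaRelativeStokes (dist1_comm_le_SU)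

/-! ## §1 Pointwise algebra of the relative field against a re-gauged background -/

section Generic

variable {P : Params} {j : ℕ} {G : Type*} [GaugeGroup G]

/-- `(c•U₀)(b) = c(b₋)·U₀(b)·c(b₊)⁻¹` (the tree's `GaugeField.gaugeAct`, by `rfl`). [cite: Balaban1985Averaging, (8) p.18] -/
theorem gaugeAct_apply_bond (c : GaugeTransf P j G) (U₀ : GaugeField P j G) (b : PBond P j) :
    GaugeField.gaugeAct c U₀ b = c b.src * U₀ b * (c b.tgt)⁻¹ := rfl

/-- ★ **THE COMMUTATOR IDENTITY**: `U₀(b)·((c•U₀)(b))⁻¹ = [U₀(b), c(b₊)]·(c(b₊)·c(b₋)⁻¹)` — a commutator with the value of `c` at the far end times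
the gradient of `c` across the bond. [cite: Balaban1985Averaging, (8) p.18] -/
theorem rel_gaugeAct_eq_comm_mul (c : GaugeTransf P j G) (U₀ : GaugeField P j G) (b : PBond P j) :
    U₀ b * (GaugeField.gaugeAct c U₀ b)⁻¹ =
      (U₀ b * c b.tgt * (U₀ b)⁻¹ * (c b.tgt)⁻¹) * (c b.tgt * (c b.src)⁻¹) := by
  show U₀ b * (c b.src * U₀ b * (c b.tgt)⁻¹)⁻¹ = _
  group

/-- INTERIOR BOND (`c(b₋) = c(b₊)`, e.g. `c` block-constant and `b` inside a block): `U₀(b)·((c•U₀)(b))⁻¹ = [U₀(b), c(b₊)]` exactly.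
[cite: Balaban1985Averaging, (8) p.18] -/
theorem rel_gaugeAct_eq_comm_of_eq (c : GaugeTransf P j G) (U₀ : GaugeField P j G) (b : PBond P j) (hb : c b.src = c b.tgt) :
    U₀ b * (GaugeField.gaugeAct c U₀ b)⁻¹ = U₀ b * c b.tgt * (U₀ b)⁻¹ * (c b.tgt)⁻¹ := by
  rw [rel_gaugeAct_eq_comm_mul, hb, mul_inv_cancel, mul_one]

/-- ★ **THE BOND LETTER**: `dist1 (U₀(b)·((c•U₀)(b))⁻¹) ≤ 2·dist1 U₀(b)·dist1 c(b₊) + dist1 (c(b₊)·c(b₋)⁻¹)`, given the commutator estimate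
`hcomm` of the group (on `SU(n)`: ✓`dist1_comm_le_SU`). [cite: Balaban1985Averaging, (8) p.18] -/
theorem dist1_rel_gaugeAct_le (hcomm : ∀ g h : G, dist1 (g * h * g⁻¹ * h⁻¹) ≤ 2 * dist1 g * dist1 h)
    (c : GaugeTransf P j G) (U₀ : GaugeField P j G) (b : PBond P j) :
    dist1 (U₀ b * (GaugeField.gaugeAct c U₀ b)⁻¹) ≤ 2 * dist1 (U₀ b) * dist1 (c b.tgt) + dist1 (c b.tgt * (c b.src)⁻¹) := by
  rw [rel_gaugeAct_eq_comm_mul]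
  exact (GaugeGroup.dist1_mul_le _ _).trans (add_le_add (hcomm _ _) le_rfl)

/-- INTERIOR BOND LETTER: `c(b₋) = c(b₊)` ⟹ `dist1 (U₀(b)·((c•U₀)(b))⁻¹) ≤ 2·dist1 U₀(b)·dist1 c(b₊)`. [cite: Balaban1985Averaging, (8) p.18] -/
theorem dist1_rel_gaugeAct_le_of_eq (hcomm : ∀ g h : G, dist1 (g * h * g⁻¹ * h⁻¹) ≤ 2 * dist1 g * dist1 h)
    (c : GaugeTransf P j G) (U₀ : GaugeField P j G) (b : PBond P j) (hb : c b.src = c b.tgt) :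
    dist1 (U₀ b * (GaugeField.gaugeAct c U₀ b)⁻¹) ≤ 2 * dist1 (U₀ b) * dist1 (c b.tgt) := by
  rw [rel_gaugeAct_eq_comm_of_eq c U₀ b hb]
  exact hcomm _ _

/-- THE SPLIT THROUGH THE BACKGROUND: `X(b)·Y(b)⁻¹ = (X(b)·U₀(b)⁻¹)·(U₀(b)·Y(b)⁻¹)`. [folklore] -/
theorem rel_split_eq (X Y U₀ : GaugeField P j G) (b : PBond P j) :
    X b * (Y b)⁻¹ = (X b * (U₀ b)⁻¹) * (U₀ b * (Y b)⁻¹) := by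
  group

/-- ★ `dist1 (X(b)·Y(b)⁻¹) ≤ dist1 (X(b)·U₀(b)⁻¹) + dist1 (U₀(b)·Y(b)⁻¹)`. [folklore] -/
theorem dist1_rel_split (X Y U₀ : GaugeField P j G) (b : PBond P j) :
    dist1 (X b * (Y b)⁻¹) ≤ dist1 (X b * (U₀ b)⁻¹) + dist1 (U₀ b * (Y b)⁻¹) :=
  (congrArg dist1 (rel_split_eq X Y U₀ b)).trans_le (GaugeGroup.dist1_mul_le _ _)

/-! ## §2 ★★★ THE COMMUTATOR LETTER -/

/-- ★★★ **(RES-u.4) THE COMMUTATOR LETTER** (architect px17 g23 2026-09-01T01:09Z; desk №704): if the fine field `X` is `a`-close to the background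
`U₀` bondwise (`hA`, Thm 2's `e^{ηA}`), the background has bond class `σ` (`hσ`), and the gauge `c` has size `τ` (`hτ` — any real; NOT assumed small) and
gradient `τ′` across bonds (`hτ′`), then the relative field of `X` against the RE-GAUGED background `c•U₀` has bond size `≤ a + 2·σ·τ + τ′` — uniformly, with
no stabiliser and no inverse orbit bound. [cite: Balaban1985Averaging, (8) p.18] -/
theorem dist1_rel_blockRegauged_le (hcomm : ∀ g h : G, dist1 (g * h * g⁻¹ * h⁻¹) ≤ 2 * dist1 g * dist1 h)
    {X U₀ : GaugeField P j G} {c : GaugeTransf P j G} {a σ τ τ' : ℝ}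
    (hA : ∀ b : PBond P j, dist1 (X b * (U₀ b)⁻¹) ≤ a) (hσ : ∀ b : PBond P j, dist1 (U₀ b) ≤ σ)
    (hτ : ∀ x : Site P j, dist1 (c x) ≤ τ) (hτ' : ∀ b : PBond P j, dist1 (c b.tgt * (c b.src)⁻¹) ≤ τ') (b : PBond P j) :
    dist1 (X b * (GaugeField.gaugeAct c U₀ b)⁻¹) ≤ a + 2 * σ * τ + τ' := by
  have h1 := dist1_rel_split X (GaugeField.gaugeAct c U₀) U₀ b
  have h2 := dist1_rel_gaugeAct_le hcomm c U₀ b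
  have h3 : 2 * dist1 (U₀ b) * dist1 (c b.tgt) ≤ 2 * σ * τ :=
    mul_le_mul (by linarith [hσ b]) (hτ b.tgt) (GaugeGroup.dist1_nonneg _)
      (by linarith [hσ b, GaugeGroup.dist1_nonneg (U₀ b)])
  linarith [hA b, hτ' b]

/-- INTERIOR EDITION (no gradient term): on a bond with `c(b₋) = c(b₊)`, `dist1 (X(b)·((c•U₀)(b))⁻¹) ≤ a + 2·σ·τ`.
[cite: Balaban1985Averaging, (8) p.18] -/
theorem dist1_rel_blockRegauged_le_of_eq (hcomm : ∀ g h : G, dist1 (g * h * g⁻¹ * h⁻¹) ≤ 2 * dist1 g * dist1 h)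
    {X U₀ : GaugeField P j G} {c : GaugeTransf P j G} {a σ τ : ℝ}
    (hA : ∀ b : PBond P j, dist1 (X b * (U₀ b)⁻¹) ≤ a) (hσ : ∀ b : PBond P j, dist1 (U₀ b) ≤ σ)
    (hτ : ∀ x : Site P j, dist1 (c x) ≤ τ) (b : PBond P j) (hb : c b.src = c b.tgt) :
    dist1 (X b * (GaugeField.gaugeAct c U₀ b)⁻¹) ≤ a + 2 * σ * τ := by
  have h1 := dist1_rel_split X (GaugeField.gaugeAct c U₀) U₀ b
  have h2 := dist1_rel_gaugeAct_le_of_eq hcomm c U₀ b hb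
  have h3 : 2 * dist1 (U₀ b) * dist1 (c b.tgt) ≤ 2 * σ * τ :=
    mul_le_mul (by linarith [hσ b]) (hτ b.tgt) (GaugeGroup.dist1_nonneg _)
      (by linarith [hσ b, GaugeGroup.dist1_nonneg (U₀ b)])
  linarith [hA b]

/-! ## §3 The seam input `τ′` from the defect identity (pointwise) -/

/-- THE GRADIENT FROM THE DEFECT, as a group identity (left frame): `t⁻¹·V·t′ = E·V` ⟹ `t′ = V⁻¹·t·E·V`, hence
`t′·t⁻¹ = (V⁻¹·t·V·t⁻¹)·(t·(V⁻¹·E·V)·t⁻¹)` — a commutator times a conjugate of `E`. [folklore] -/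
theorem grad_eq_of_defect_left {G' : Type*} [Group G'] (t t' V E : G') (h : t⁻¹ * V * t' = E * V) :
    t' * t⁻¹ = (V⁻¹ * t * V * t⁻¹) * (t * (V⁻¹ * E * V) * t⁻¹) := by
  have ht' : t' = V⁻¹ * t * (E * V) := by
    calc t' = V⁻¹ * t * (t⁻¹ * V * t') := by group
      _ = V⁻¹ * t * (E * V) := by rw [h]
  rw [ht']
  group

/-- THE GRADIENT FROM THE DEFECT (right frame): `t⁻¹·V·t′ = V·E` ⟹ `t′·t⁻¹ = (V⁻¹·t·V·t⁻¹)·(t·E·t⁻¹)`. [folklore] -/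
theorem grad_eq_of_defect_right {G' : Type*} [Group G'] (t t' V E : G') (h : t⁻¹ * V * t' = V * E) :
    t' * t⁻¹ = (V⁻¹ * t * V * t⁻¹) * (t * E * t⁻¹) := by
  have ht' : t' = V⁻¹ * t * (V * E) := by
    calc t' = V⁻¹ * t * (t⁻¹ * V * t') := by group
      _ = V⁻¹ * t * (V * E) := by rw [h]
  rw [ht']
  group

/-- `dist1 (V⁻¹·t·V·t⁻¹) ≤ 2·dist1 t·dist1 V` from `hcomm` (it is the commutator `[V⁻¹, t]`, and `dist1` is inversion-invariant). [folklore] -/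
theorem dist1_conjComm_le (hcomm : ∀ g h : G, dist1 (g * h * g⁻¹ * h⁻¹) ≤ 2 * dist1 g * dist1 h) (t V : G) :
    dist1 (V⁻¹ * t * V * t⁻¹) ≤ 2 * dist1 t * dist1 V := by
  have h := hcomm V⁻¹ t
  rw [inv_inv, GaugeGroup.dist1_inv] at h
  calc dist1 (V⁻¹ * t * V * t⁻¹) ≤ 2 * dist1 V * dist1 t := h
    _ = 2 * dist1 t * dist1 V := by ring

/-- ★ **THE COARSE-GRADIENT LETTER FROM THE DEFECT IDENTITY** (desk №704 (ii), left frame): if `(t b₋)⁻¹·V(b)·t b₊ = E(b)·V(b)` on every bond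
(`t⁻¹•V = E·V`, the `α₁`-approximate stabiliser reading of [Balaban1985RegularSpaces] Thm 2's (1.37) p.82), then
`dist1 (t b₊·(t b₋)⁻¹) ≤ 2·dist1 (t b₋)·dist1 V(b) + dist1 E(b)`. [cite: Balaban1985RegularSpaces, Thm 2 p.83, (1.36)-(1.38) p.82] -/
theorem dist1_coarseGrad_le_of_defect (hcomm : ∀ g h : G, dist1 (g * h * g⁻¹ * h⁻¹) ≤ 2 * dist1 g * dist1 h)
    {t : GaugeTransf P j G} {V : GaugeField P j G} {E : PBond P j → G}
    (h : ∀ b : PBond P j, (t b.src)⁻¹ * V b * t b.tgt = E b * V b) (b : PBond P j) :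
    dist1 (t b.tgt * (t b.src)⁻¹) ≤ 2 * dist1 (t b.src) * dist1 (V b) + dist1 (E b) := by
  rw [grad_eq_of_defect_left (t b.src) (t b.tgt) (V b) (E b) (h b)]
  refine (GaugeGroup.dist1_mul_le _ _).trans (add_le_add (dist1_conjComm_le hcomm _ _) (le_of_eq ?_))
  rw [GaugeGroup.dist1_conj]
  have := GaugeGroup.dist1_conj (E b) (V b)⁻¹
  rwa [inv_inv] at this

/-- RIGHT-FRAME EDITION: `(t b₋)⁻¹·V(b)·t b₊ = V(b)·E(b)` ⟹ `dist1 (t b₊·(t b₋)⁻¹) ≤ 2·dist1 (t b₋)·dist1 V(b) + dist1 E(b)`.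
[cite: Balaban1985RegularSpaces, Thm 2 p.83, (1.36)-(1.38) p.82] -/
theorem dist1_coarseGrad_le_of_defect_right (hcomm : ∀ g h : G, dist1 (g * h * g⁻¹ * h⁻¹) ≤ 2 * dist1 g * dist1 h)
    {t : GaugeTransf P j G} {V : GaugeField P j G} {E : PBond P j → G}
    (h : ∀ b : PBond P j, (t b.src)⁻¹ * V b * t b.tgt = V b * E b) (b : PBond P j) :
    dist1 (t b.tgt * (t b.src)⁻¹) ≤ 2 * dist1 (t b.src) * dist1 (V b) + dist1 (E b) := by
  rw [grad_eq_of_defect_right (t b.src) (t b.tgt) (V b) (E b) (h b)]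
  refine (GaugeGroup.dist1_mul_le _ _).trans (add_le_add (dist1_conjComm_le hcomm _ _) (le_of_eq ?_))
  rw [GaugeGroup.dist1_conj]

/-- THE COARSE-GRADIENT LETTER WITH SIZES: `t⁻¹•V = E·V`, `dist1 (t x) ≤ τ`, `dist1 V(b) ≤ σV`, `dist1 E(b) ≤ e` ⟹ `dist1 (t b₊·(t b₋)⁻¹) ≤ 2·τ·σV + e`
— the `τ′` of §2. [cite: Balaban1985RegularSpaces, Thm 2 p.83, (1.36)-(1.38) p.82] -/
theorem dist1_coarseGrad_le_of_defect_sizes (hcomm : ∀ g h : G, dist1 (g * h * g⁻¹ * h⁻¹) ≤ 2 * dist1 g * dist1 h)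
    {t : GaugeTransf P j G} {V : GaugeField P j G} {E : PBond P j → G} {τ σV e : ℝ}
    (h : ∀ b : PBond P j, (t b.src)⁻¹ * V b * t b.tgt = E b * V b)
    (hτ : ∀ x : Site P j, dist1 (t x) ≤ τ) (hσV : ∀ b : PBond P j, dist1 (V b) ≤ σV) (hE : ∀ b : PBond P j, dist1 (E b) ≤ e)
    (b : PBond P j) : dist1 (t b.tgt * (t b.src)⁻¹) ≤ 2 * τ * σV + e := by
  have h1 := dist1_coarseGrad_le_of_defect hcomm h b
  have h3 : 2 * dist1 (t b.src) * dist1 (V b) ≤ 2 * τ * σV :=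
    mul_le_mul (by linarith [hτ b.src]) (hσV b) (GaugeGroup.dist1_nonneg _)
      (by linarith [hτ b.src, GaugeGroup.dist1_nonneg (t b.src)])
  linarith [hE b]

/-! ### §3′ The framed defect (px16 g24's B7 (82)∕(85)∕(89) reading: `t⁻¹•V = w•(E·V)` with an axial FRAME gauge `w`) -/

/-- FRAME CHANGE FOR A GRADIENT: `t(b₊)·t(b₋)⁻¹ = ((t·w)(b₊)·((t·w)(b₋))⁻¹)·(t(b₋)·(w(b₋)·w(b₊)⁻¹)·t(b₋)⁻¹)`, hence
`dist1 (t b₊·(t b₋)⁻¹) ≤ dist1 ((t b₊·w b₊)·(t b₋·w b₋)⁻¹) + dist1 (w b₊·(w b₋)⁻¹)` — a frame gauge costs its own gradient, additively. [folklore] -/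
theorem dist1_grad_le_framed (t w : GaugeTransf P j G) (b : PBond P j) :
    dist1 (t b.tgt * (t b.src)⁻¹) ≤
      dist1 ((t b.tgt * w b.tgt) * (t b.src * w b.src)⁻¹) + dist1 (w b.tgt * (w b.src)⁻¹) := by
  have e : t b.tgt * (t b.src)⁻¹ =
      ((t b.tgt * w b.tgt) * (t b.src * w b.src)⁻¹) * (t b.src * (w b.tgt * (w b.src)⁻¹)⁻¹ * (t b.src)⁻¹) := by
    group
  rw [e]
  refine (GaugeGroup.dist1_mul_le _ _).trans (add_le_add le_rfl (le_of_eq ?_))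
  rw [GaugeGroup.dist1_conj, GaugeGroup.dist1_inv]

/-- ★ **THE COARSE-GRADIENT LETTER FROM THE FRAMED DEFECT IDENTITY**: if `((t·w) b₋)⁻¹·V(b)·(t·w) b₊ = E(b)·V(b)` on every bond (i.e.
`t⁻¹•V = w•(E·V)`, the frame gauge `w` of B7 (82)∕(85) made explicit), then
`dist1 (t b₊·(t b₋)⁻¹) ≤ 2·dist1 (t b₋·w b₋)·dist1 V(b) + dist1 E(b) + dist1 (w b₊·(w b₋)⁻¹)`. [cite: Balaban1985RegularSpaces, Thm 2 p.83, (1.36)-(1.38) p.82] -/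
theorem dist1_coarseGrad_le_of_framedDefect (hcomm : ∀ g h : G, dist1 (g * h * g⁻¹ * h⁻¹) ≤ 2 * dist1 g * dist1 h)
    {t w : GaugeTransf P j G} {V : GaugeField P j G} {E : PBond P j → G}
    (h : ∀ b : PBond P j, (t b.src * w b.src)⁻¹ * V b * (t b.tgt * w b.tgt) = E b * V b) (b : PBond P j) :
    dist1 (t b.tgt * (t b.src)⁻¹) ≤
      2 * dist1 (t b.src * w b.src) * dist1 (V b) + dist1 (E b) + dist1 (w b.tgt * (w b.src)⁻¹) := by
  have h1 := dist1_coarseGrad_le_of_defect hcomm (t := fun x => t x * w x) (V := V) (E := E) h b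
  have h2 := dist1_grad_le_framed t w b
  linarith

/-- FRAMED EDITION WITH SIZES: `dist1 V(b) ≤ σV`, `dist1 E(b) ≤ e`, frame gradient `dist1 (w b₊·(w b₋)⁻¹) ≤ ω′`, and `dist1 ((t·w) x) ≤ τ` ⟹
`dist1 (t b₊·(t b₋)⁻¹) ≤ 2·τ·σV + e + ω′`. [cite: Balaban1985RegularSpaces, Thm 2 p.83, (1.36)-(1.38) p.82] -/
theorem dist1_coarseGrad_le_of_framedDefect_sizes (hcomm : ∀ g h : G, dist1 (g * h * g⁻¹ * h⁻¹) ≤ 2 * dist1 g * dist1 h)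
    {t w : GaugeTransf P j G} {V : GaugeField P j G} {E : PBond P j → G} {τ σV e ω' : ℝ}
    (h : ∀ b : PBond P j, (t b.src * w b.src)⁻¹ * V b * (t b.tgt * w b.tgt) = E b * V b)
    (hτ : ∀ x : Site P j, dist1 (t x * w x) ≤ τ) (hσV : ∀ b : PBond P j, dist1 (V b) ≤ σV)
    (hE : ∀ b : PBond P j, dist1 (E b) ≤ e) (hω' : ∀ b : PBond P j, dist1 (w b.tgt * (w b.src)⁻¹) ≤ ω') (b : PBond P j) :
    dist1 (t b.tgt * (t b.src)⁻¹) ≤ 2 * τ * σV + e + ω' := by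
  have h1 := dist1_coarseGrad_le_of_framedDefect hcomm h b
  have h3 : 2 * dist1 (t b.src * w b.src) * dist1 (V b) ≤ 2 * τ * σV :=
    mul_le_mul (by linarith [hτ b.src]) (hσV b) (GaugeGroup.dist1_nonneg _)
      (by linarith [hτ b.src, GaugeGroup.dist1_nonneg (t b.src * w b.src)])
  linarith [hE b, hω' b]

end Generic

/-! ## §2′/§3′ The `SU(n)` editions (`hcomm` discharged by ✓`dist1_comm_le_SU`, `τ := 2` by ✓`dist1_le_two_specialUnitaryGroup`) -/

section SU

variable {P : Params} {j : ℕ} {n : Type*} [Fintype n] [DecidableEq n] [Nonempty n]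

/-- ★★★ **THE COMMUTATOR LETTER ON `SU(n)`**: `dist1 (X(b)·((c•U₀)(b))⁻¹) ≤ a + 4·σ + τ′` — inputs `(a, σ, τ′)` only (the size of `c` enters through
`dist1 ≤ 2`). [cite: Balaban1985Averaging, (8) p.18] -/
theorem dist1_rel_blockRegauged_le_SU {X U₀ : GaugeField P j (Matrix.specialUnitaryGroup n ℂ)}
    {c : GaugeTransf P j (Matrix.specialUnitaryGroup n ℂ)} {a σ τ' : ℝ}
    (hA : ∀ b : PBond P j, dist1 (X b * (U₀ b)⁻¹) ≤ a) (hσ : ∀ b : PBond P j, dist1 (U₀ b) ≤ σ)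
    (hτ' : ∀ b : PBond P j, dist1 (c b.tgt * (c b.src)⁻¹) ≤ τ') (b : PBond P j) :
    dist1 (X b * (GaugeField.gaugeAct c U₀ b)⁻¹) ≤ a + 4 * σ + τ' := by
  have h := dist1_rel_blockRegauged_le dist1_comm_le_SU hA hσ
    (fun x => dist1_le_two_specialUnitaryGroup (c x)) hτ' b
  linarith

/-- INTERIOR EDITION ON `SU(n)`: `c(b₋) = c(b₊)` ⟹ `dist1 (X(b)·((c•U₀)(b))⁻¹) ≤ a + 4·σ`. [cite: Balaban1985Averaging, (8) p.18] -/
theorem dist1_rel_blockRegauged_le_SU_of_eq {X U₀ : GaugeField P j (Matrix.specialUnitaryGroup n ℂ)}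
    {c : GaugeTransf P j (Matrix.specialUnitaryGroup n ℂ)} {a σ : ℝ}
    (hA : ∀ b : PBond P j, dist1 (X b * (U₀ b)⁻¹) ≤ a) (hσ : ∀ b : PBond P j, dist1 (U₀ b) ≤ σ)
    (b : PBond P j) (hb : c b.src = c b.tgt) :
    dist1 (X b * (GaugeField.gaugeAct c U₀ b)⁻¹) ≤ a + 4 * σ := by
  have h := dist1_rel_blockRegauged_le_of_eq dist1_comm_le_SU hA hσ
    (fun x => dist1_le_two_specialUnitaryGroup (c x)) b hb
  linarith

/-- ★ **THE COARSE-GRADIENT LETTER ON `SU(n)`** (desk №704 (ii) verbatim): `t⁻¹•V = E·V`, `dist1 V(b) ≤ σV`, `dist1 E(b) ≤ e` ⟹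
`dist1 (t b₊·(t b₋)⁻¹) ≤ 4·σV + e`. [cite: Balaban1985RegularSpaces, Thm 2 p.83, (1.36)-(1.38) p.82] -/
theorem dist1_coarseGrad_le_of_defect_SU {t : GaugeTransf P j (Matrix.specialUnitaryGroup n ℂ)}
    {V : GaugeField P j (Matrix.specialUnitaryGroup n ℂ)} {E : PBond P j → Matrix.specialUnitaryGroup n ℂ} {σV e : ℝ}
    (h : ∀ b : PBond P j, (t b.src)⁻¹ * V b * t b.tgt = E b * V b)
    (hσV : ∀ b : PBond P j, dist1 (V b) ≤ σV) (hE : ∀ b : PBond P j, dist1 (E b) ≤ e) (b : PBond P j) :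
    dist1 (t b.tgt * (t b.src)⁻¹) ≤ 4 * σV + e := by
  have h1 := dist1_coarseGrad_le_of_defect_sizes dist1_comm_le_SU h
    (fun x => dist1_le_two_specialUnitaryGroup (t x)) hσV hE b
  linarith

/-- ★ **THE FRAMED COARSE-GRADIENT LETTER ON `SU(n)`**: `t⁻¹•V = w•(E·V)` (frame `w`), `dist1 V(b) ≤ σV`, `dist1 E(b) ≤ e`,
`dist1 (w b₊·(w b₋)⁻¹) ≤ ω′` ⟹ `dist1 (t b₊·(t b₋)⁻¹) ≤ 4·σV + e + ω′`. [cite: Balaban1985RegularSpaces, Thm 2 p.83, (1.36)-(1.38) p.82] -/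
theorem dist1_coarseGrad_le_of_framedDefect_SU {t w : GaugeTransf P j (Matrix.specialUnitaryGroup n ℂ)}
    {V : GaugeField P j (Matrix.specialUnitaryGroup n ℂ)} {E : PBond P j → Matrix.specialUnitaryGroup n ℂ} {σV e ω' : ℝ}
    (h : ∀ b : PBond P j, (t b.src * w b.src)⁻¹ * V b * (t b.tgt * w b.tgt) = E b * V b)
    (hσV : ∀ b : PBond P j, dist1 (V b) ≤ σV) (hE : ∀ b : PBond P j, dist1 (E b) ≤ e)
    (hω' : ∀ b : PBond P j, dist1 (w b.tgt * (w b.src)⁻¹) ≤ ω') (b : PBond P j) :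
    dist1 (t b.tgt * (t b.src)⁻¹) ≤ 4 * σV + e + ω' := by
  have h1 := dist1_coarseGrad_le_of_framedDefect_sizes dist1_comm_le_SU h
    (fun x => dist1_le_two_specialUnitaryGroup (t x * w x)) hσV hE hω' b
  linarith

end SU

/-! ## §4 The block-constant instance `c := liftTransfTo F n K h t` -/

section Lift

variable (F : T3Family) {G : Type*} [GaugeGroup G] (n K : ℕ) (h : n ≤ K)

omit [GaugeGroup G] in
/-- `(liftTransfTo t)(z) = t (π z)`, `π := siteShift⁻¹ ∘ blockUp (K − n)` (by `rfl`). [cite: Balaban1985Averaging, (12) p.19] -/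
theorem liftTransfTo_apply (t : GaugeTransf (F.P n) 0 G) (z : Site (F.P K) 0) :
    liftTransfTo F n K h t z = t ((siteShift (sites_eq F n K h)).symm (blockUp (K - n) z)) := rfl

/-- THE SIZE OF THE LIFT IS THE SIZE OF `t`: `dist1 (t y) ≤ τ` for all coarse `y` ⟹ `dist1 ((liftTransfTo t) z) ≤ τ` for all fine `z`.
[cite: Balaban1985Averaging, (12) p.19] -/
theorem dist1_liftTransfTo_le {t : GaugeTransf (F.P n) 0 G} {τ : ℝ} (hτ : ∀ y : Site (F.P n) 0, dist1 (t y) ≤ τ)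
    (z : Site (F.P K) 0) : dist1 (liftTransfTo F n K h t z) ≤ τ :=
  hτ _

/-- THE GRADIENT OF THE LIFT ACROSS A FINE BOND IS `t`'S GRADIENT ACROSS THE IMAGE PAIR (by `rfl`). [cite: Balaban1985Averaging, (12) p.19] -/
theorem liftTransfTo_grad (t : GaugeTransf (F.P n) 0 G) (b : PBond (F.P K) 0) :
    liftTransfTo F n K h t b.tgt * (liftTransfTo F n K h t b.src)⁻¹ =
      t ((siteShift (sites_eq F n K h)).symm (blockUp (K - n) b.tgt)) *
        (t ((siteShift (sites_eq F n K h)).symm (blockUp (K - n) b.src)))⁻¹ := rfl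

omit [GaugeGroup G] in
/-- INTERIOR BONDS: if both ends of the fine bond `b` lie in ONE `(K − n)`-block, the lift takes EQUAL values at the two ends (the `hb` of
§1∕§2's interior editions). [cite: Balaban1985Averaging, (12) p.19] -/
theorem liftTransfTo_src_eq_tgt_of_sameBlock (t : GaugeTransf (F.P n) 0 G) (b : PBond (F.P K) 0)
    (hb : blockUp (K - n) b.src = blockUp (K - n) b.tgt) :
    liftTransfTo F n K h t b.src = liftTransfTo F n K h t b.tgt :=
  congrArg (fun y => t ((siteShift (sites_eq F n K h)).symm y)) hb

/-- ★ INTERIOR BONDS CARRY NO GRADIENT: if both ends of the fine bond `b` lie in ONE `(K − n)`-block, the lift's gradient across `b` is `1`, of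
`dist1` zero — so the `τ′`-term of §2 is absent on every bond interior to a block. [cite: Balaban1985Averaging, (12) p.19] -/
theorem dist1_liftTransfTo_grad_of_sameBlock (t : GaugeTransf (F.P n) 0 G) (b : PBond (F.P K) 0)
    (hb : blockUp (K - n) b.src = blockUp (K - n) b.tgt) :
    dist1 (liftTransfTo F n K h t b.tgt * (liftTransfTo F n K h t b.src)⁻¹) = 0 := by
  rw [liftTransfTo_src_eq_tgt_of_sameBlock F n K h t b hb, mul_inv_cancel, GaugeGroup.dist1_one]

/-- INTERIOR BONDS, LETTER FORM: inside a block the commutator letter of §2 has no `τ′`-term —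
`dist1 (X(b)·(((liftTransfTo t)•U₀)(b))⁻¹) ≤ a + 2·σ·τ`. [cite: Balaban1985Averaging, (8) p.18, (12) p.19] -/
theorem dist1_rel_liftRegauged_le_of_sameBlock (hcomm : ∀ g g' : G, dist1 (g * g' * g⁻¹ * g'⁻¹) ≤ 2 * dist1 g * dist1 g')
    {X U₀ : GaugeField (F.P K) 0 G} {t : GaugeTransf (F.P n) 0 G} {a σ τ : ℝ}
    (hA : ∀ b : PBond (F.P K) 0, dist1 (X b * (U₀ b)⁻¹) ≤ a) (hσ : ∀ b : PBond (F.P K) 0, dist1 (U₀ b) ≤ σ)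
    (hτ : ∀ y : Site (F.P n) 0, dist1 (t y) ≤ τ) (b : PBond (F.P K) 0) (hb : blockUp (K - n) b.src = blockUp (K - n) b.tgt) :
    dist1 (X b * (GaugeField.gaugeAct (liftTransfTo F n K h t) U₀ b)⁻¹) ≤ a + 2 * σ * τ :=
  dist1_rel_blockRegauged_le_of_eq hcomm hA hσ (fun z => dist1_liftTransfTo_le F n K h hτ z) b
    (liftTransfTo_src_eq_tgt_of_sameBlock F n K h t b hb)

/-- THE GRADIENT LETTER PASSES TO THE LIFT: if `t`'s gradient over every image pair `(π b₋, π b₊)` of a fine bond is `≤ τ′`, then so is the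
lift's over every fine bond — the reading (RES-u.5) consumes. [cite: Balaban1985Averaging, (12) p.19] -/
theorem dist1_liftTransfTo_grad_le {t : GaugeTransf (F.P n) 0 G} {τ' : ℝ}
    (hτ' : ∀ b : PBond (F.P K) 0,
      dist1 (t ((siteShift (sites_eq F n K h)).symm (blockUp (K - n) b.tgt)) *
          (t ((siteShift (sites_eq F n K h)).symm (blockUp (K - n) b.src)))⁻¹) ≤ τ')
    (b : PBond (F.P K) 0) :
    dist1 (liftTransfTo F n K h t b.tgt * (liftTransfTo F n K h t b.src)⁻¹) ≤ τ' :=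
  hτ' b

/-- ★★ **THE COMMUTATOR LETTER AT THE LIFT** (the (RES-u) instance `c := liftTransfTo t`): closeness `a`, background class `σ`, size `τ` and
image-pair gradient `τ′` of the COARSE transformation `t` ⟹ `dist1 (X(b)·(((liftTransfTo t)•U₀)(b))⁻¹) ≤ a + 2·σ·τ + τ′` on every fine bond.
[cite: Balaban1985Averaging, (8) p.18, (12) p.19] -/
theorem dist1_rel_liftRegauged_le (hcomm : ∀ g g' : G, dist1 (g * g' * g⁻¹ * g'⁻¹) ≤ 2 * dist1 g * dist1 g')
    {X U₀ : GaugeField (F.P K) 0 G} {t : GaugeTransf (F.P n) 0 G} {a σ τ τ' : ℝ}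
    (hA : ∀ b : PBond (F.P K) 0, dist1 (X b * (U₀ b)⁻¹) ≤ a) (hσ : ∀ b : PBond (F.P K) 0, dist1 (U₀ b) ≤ σ)
    (hτ : ∀ y : Site (F.P n) 0, dist1 (t y) ≤ τ)
    (hτ' : ∀ b : PBond (F.P K) 0,
      dist1 (t ((siteShift (sites_eq F n K h)).symm (blockUp (K - n) b.tgt)) *
          (t ((siteShift (sites_eq F n K h)).symm (blockUp (K - n) b.src)))⁻¹) ≤ τ')
    (b : PBond (F.P K) 0) :
    dist1 (X b * (GaugeField.gaugeAct (liftTransfTo F n K h t) U₀ b)⁻¹) ≤ a + 2 * σ * τ + τ' :=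
  dist1_rel_blockRegauged_le hcomm hA hσ (fun z => dist1_liftTransfTo_le F n K h hτ z)
    (fun b' => dist1_liftTransfTo_grad_le F n K h hτ' b') b

end Lift

end Summit.QuantumFields.YangMills.Theorems.FluctuationComparisonRegPrIntLS2BetaResidualCommutatorLetter

end
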